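import Literature.Analysis.Convolution.ConvolutionPowerIntegerArithmetic
import HarnessLib

/-!
# Packed-digit big-integer primitives for the Fekete–Pólya block certificates

Topic `Literature/NumberTheory/LFunctions`; namespace `Literature.NumberTheory.LFunctions.FeketePolyaKernel`.
Small computable definitions and THEOREMS (no named fact, no `sorry`): the kernel-side arithmetic of the
engine v4 of the Fekete–Pólya lane (`FeketePolyaKernelCertificatesBlock*.lean`), which walks the iterated
partial sums of a character BLOCKWISE — a block of `L` consecutive positions is ONE natural number carrying
`L` digits in base `2^b` (the Kronecker packing `kpack b L d = Σ_{j<L} d_j 2^{bj}` of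
`Literature.Analysis.Convolution.ConvolutionPowerIntegerArithmetic`), so that prefix sums, digitwise products
of sign tables, periodic extension and the sign test cost `O(1)` big-integer operations of the kernel
(GMP-backed `Nat.mul / Nat.land / Nat.lor / Nat.shiftRight / …`) per block instead of `O(L)` recursion steps.

* `onesV b n = (2^{bn} − 1)/(2^b − 1) = Σ_{j<n} 2^{bj}` (`onesV_eq_kpack`); scalar multiples, differences,
  digitwise `&&&` / `|||` of packed vectors (`kpack_smul`, `kpack_tsub`, `kpack_land`, `kpack_lor`), digit
  extraction `dig` (`dig_kpack`), low part / high part (`kpack_land_low`, `kpack_shiftRight_high`);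
* PREFIX SUMS by one multiplication: `(kpack b L d · onesV b L) &&& (2^{bL} − 1) = kpack b L (psumF d)` when
  `Σ_{j<L} d_j < 2^b` (`kpack_mul_onesV_low`; the product is the packed convolution with the all-ones vector,
  `kpack_mul_kpack`);
* SPREADING the bits of a bitset to digits: `spreadChunk b c x = (x · onesV (b−1) c) &&& onesV b c` puts bit
  `r < c ≤ b − 1` of `x` at digit `r` (`spreadChunk_eq`: in base `2^{b−1}` the product has all digits `x`, and
  bit `br = (b−1)r + r` of it is bit `r` of digit `r`), `spreadBits` chunk by chunk (`spreadBits_eq`);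
* PERIODIC EXTENSION by one multiplication: `pext b L n T = T · onesV (bL) n` is `n` copies of a table of `L`
  digits (`pext_kpack`).

## References

* J. von zur Gathen, J. Gerhard, *Modern Computer Algebra*, 3rd ed., CUP 2013, §8.4 (Kronecker substitution).
  [GathenGerhard2013ModernComputerAlgebra]
-/

namespace Literature.NumberTheory.LFunctions

namespace FeketePolyaKernel

open Finset Literature.Analysis.Convolution

/-! ### The all-ones vector; scalar multiples, differences and digitwise operations of packed vectors -/

/-- `onesV b n = (2^{bn} − 1)/(2^b − 1)` (`= Σ_{j<n} 2^{bj}`, the packed vector of `n` digits `1`).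
[cite: GathenGerhard2013ModernComputerAlgebra, §8.4 (Kronecker substitution)] -/
def onesV (b n : ℕ) : ℕ := (2 ^ (b * n) - 1) / (2 ^ b - 1)

/-- `onesV b n = kpack b n 1` (`b ≥ 1`; the geometric sum). [cite: GathenGerhard2013ModernComputerAlgebra, §8.4 (Kronecker substitution)] -/
theorem onesV_eq_kpack {b : ℕ} (hb : 1 ≤ b) (n : ℕ) : onesV b n = kpack b n fun _ => 1 := by
  have h2 : 2 ≤ 2 ^ b := by
    calc (2 : ℕ) = 2 ^ 1 := rfl
      _ ≤ 2 ^ b := Nat.pow_le_pow_right (by norm_num) hb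
  unfold onesV kpack
  rw [pow_mul, ← Nat.geomSum_eq h2 n]
  exact Finset.sum_congr rfl fun j _ => by rw [one_mul, pow_mul]

/-- Scalar multiple: `c · kpack b n d = kpack b n (c d)`. [cite: GathenGerhard2013ModernComputerAlgebra, §8.4 (Kronecker substitution)] -/
theorem kpack_smul (b n c : ℕ) (d : ℕ → ℕ) : c * kpack b n d = kpack b n fun j => c * d j := by
  unfold kpack
  rw [Finset.mul_sum]
  exact Finset.sum_congr rfl fun j _ => by ring

/-- The zero vector. [cite: GathenGerhard2013ModernComputerAlgebra, §8.4 (Kronecker substitution)] -/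
theorem kpack_zero_fun (b n : ℕ) : kpack b n (fun _ => 0) = 0 :=
  Finset.sum_eq_zero fun j _ => by rw [zero_mul]

/-- Extending a packed vector by zero digits does not change it. [cite: GathenGerhard2013ModernComputerAlgebra, §8.4 (Kronecker substitution)] -/
theorem kpack_extend {b n r : ℕ} {d e : ℕ → ℕ} (hlo : ∀ j < n, e j = d j) (hhi : ∀ j, n ≤ j → j < n + r → e j = 0) :
    kpack b (n + r) e = kpack b n d := by
  rw [kpack_add, kpack_congr hlo]
  have : kpack b r (fun i => e (n + i)) = kpack b r fun _ => 0 :=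
    kpack_congr fun i hi => hhi (n + i) (by omega) (by omega)
  rw [this, kpack_zero_fun, mul_zero, add_zero]

/-- Difference of packed vectors, digitwise dominated: `kpack f − kpack g = kpack (f − g)` (`g ≤ f` slotwise).
[cite: GathenGerhard2013ModernComputerAlgebra, §8.4 (Kronecker substitution)] -/
theorem kpack_tsub {b n : ℕ} {f g : ℕ → ℕ} (h : ∀ j < n, g j ≤ f j) :
    kpack b n f - kpack b n g = kpack b n fun j => f j - g j := by
  have : kpack b n g + kpack b n (fun j => f j - g j) = kpack b n f := by
    rw [kpack_add_kpack]
    exact kpack_congr fun j hj => Nat.add_sub_cancel' (h j hj)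
  omega

/-- Digitwise `&&&` of packed vectors with digits `< 2^b`. [cite: GathenGerhard2013ModernComputerAlgebra, §8.4 (Kronecker substitution)] -/
theorem kpack_land {b n : ℕ} (hb : 0 < b) {f g : ℕ → ℕ} (hf : ∀ j < n, f j < 2 ^ b) (hg : ∀ j < n, g j < 2 ^ b) :
    kpack b n f &&& kpack b n g = kpack b n fun j => f j &&& g j := by
  have hfg : ∀ j < n, (fun j => f j &&& g j) j < 2 ^ b := fun j hj => Nat.and_lt_two_pow _ (hg j hj)
  refine Nat.eq_of_testBit_eq fun i => ?_
  rw [Nat.testBit_and, testBit_kpack hb hf, testBit_kpack hb hg, testBit_kpack hb hfg]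
  by_cases h : i / b < n
  · simp only [if_pos h, Nat.testBit_and]
  · simp only [if_neg h, Bool.false_and]

/-- Digitwise `|||` of packed vectors with digits `< 2^b`. [cite: GathenGerhard2013ModernComputerAlgebra, §8.4 (Kronecker substitution)] -/
theorem kpack_lor {b n : ℕ} (hb : 0 < b) {f g : ℕ → ℕ} (hf : ∀ j < n, f j < 2 ^ b) (hg : ∀ j < n, g j < 2 ^ b) :
    kpack b n f ||| kpack b n g = kpack b n fun j => f j ||| g j := by
  have hfg : ∀ j < n, (fun j => f j ||| g j) j < 2 ^ b := fun j hj => Nat.or_lt_two_pow (hf j hj) (hg j hj)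
  refine Nat.eq_of_testBit_eq fun i => ?_
  rw [Nat.testBit_or, testBit_kpack hb hf, testBit_kpack hb hg, testBit_kpack hb hfg]
  by_cases h : i / b < n
  · simp only [if_pos h, Nat.testBit_or]
  · simp only [if_neg h, Bool.false_or]

/-- Digit `j` of a packed vector: `(P >>> bj) &&& (2^b − 1)`. [cite: GathenGerhard2013ModernComputerAlgebra, §8.4 (the 2^{64t}-adic representation)] -/
def dig (b P j : ℕ) : ℕ := (P >>> (b * j)) &&& (2 ^ b - 1)

/-- `dig = kdigit`. [cite: GathenGerhard2013ModernComputerAlgebra, §8.4 (the 2^{64t}-adic representation)] -/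
theorem dig_eq_kdigit (b P j : ℕ) : dig b P j = kdigit b P j := by
  rw [dig, kdigit, Nat.and_two_pow_sub_one_eq_mod, Nat.shiftRight_eq_div_pow]

/-- Reading a digit: `dig b (kpack b n d) j = d j` (`j < n`, digits `< 2^b`), else `0`.
[cite: GathenGerhard2013ModernComputerAlgebra, §8.4 (the 2^{64t}-adic representation)] -/
theorem dig_kpack {b n : ℕ} {d : ℕ → ℕ} (hd : ∀ j < n, d j < 2 ^ b) (j : ℕ) :
    dig b (kpack b n d) j = if j < n then d j else 0 := by
  rw [dig_eq_kdigit, kdigit_kpack hd]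

/-- The low `L` digits: `kpack b n d &&& (2^{bL} − 1) = kpack b L d` (`L ≤ n`, those digits `< 2^b`).
[cite: GathenGerhard2013ModernComputerAlgebra, §8.4 (Kronecker substitution)] -/
theorem kpack_land_low {b n L : ℕ} {d : ℕ → ℕ} (hL : L ≤ n) (hd : ∀ j < L, d j < 2 ^ b) :
    kpack b n d &&& (2 ^ (b * L) - 1) = kpack b L d := by
  rw [Nat.and_two_pow_sub_one_eq_mod, kpack_mod_two_pow hL hd]

/-- The high digits: `kpack b (L + r) d >>> bL = kpack b r (d (L + ·))` (low digits `< 2^b`).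
[cite: GathenGerhard2013ModernComputerAlgebra, §8.4 (Kronecker substitution)] -/
theorem kpack_shiftRight_high {b L r : ℕ} {d : ℕ → ℕ} (hd : ∀ j < L, d j < 2 ^ b) :
    kpack b (L + r) d >>> (b * L) = kpack b r fun i => d (L + i) := by
  rw [Nat.shiftRight_eq_div_pow, kpack_add, Nat.add_mul_div_left _ _ (by positivity),
    Nat.div_eq_of_lt (kpack_lt hd), zero_add]

/-! ### Prefix sums by one multiplication -/

/-- Prefix sums `psumF d j = Σ_{i ≤ j} d_i`. [cite: GathenGerhard2013ModernComputerAlgebra, §8.4 (Kronecker substitution)] -/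
def psumF (d : ℕ → ℕ) (j : ℕ) : ℕ := ∑ i ∈ range (j + 1), d i

/-- The convolution with the all-ones vector of length `L` is the prefix sum in the slots `m < L`.
[cite: GathenGerhard2013ModernComputerAlgebra, §2.3 (4)] -/
theorem dconvNat_truncSeq_ones (d : ℕ → ℕ) {L m : ℕ} (hm : m < L) :
    dconvNat (truncSeq L d) (truncSeq L fun _ => 1) m = psumF d m := by
  unfold dconvNat psumF
  rw [Finset.Nat.sum_antidiagonal_eq_sum_range_succ (fun i j => truncSeq L d i * truncSeq L (fun _ => 1) j) m]
  refine Finset.sum_congr rfl fun i hi => ?_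
  rw [Finset.mem_range] at hi
  rw [truncSeq_of_lt d (show i < L by omega), truncSeq_of_lt (fun _ => (1 : ℕ)) (show m - i < L by omega), mul_one]

/-- A prefix sum is at most the total over the `L` slots (`j < L`). [cite: GathenGerhard2013ModernComputerAlgebra, §8.4 (Kronecker substitution)] -/
theorem psumF_le_sum (d : ℕ → ℕ) {L j : ℕ} (hj : j < L) : psumF d j ≤ ∑ i ∈ range L, d i := by
  unfold psumF
  exact Finset.sum_le_sum_of_subset fun x hx =>
    Finset.mem_range.2 (lt_of_lt_of_le (Finset.mem_range.1 hx) (by omega))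

/-- A prefix sum is at most `L` times a bound for the digits (`j < L`). [cite: GathenGerhard2013ModernComputerAlgebra, §8.4 (Kronecker substitution)] -/
theorem psumF_le_mul (d : ℕ → ℕ) {L j D : ℕ} (hj : j < L) (hD : ∀ i < L, d i ≤ D) : psumF d j ≤ L * D := by
  refine (psumF_le_sum d hj).trans ?_
  calc ∑ i ∈ range L, d i ≤ ∑ _i ∈ range L, D := Finset.sum_le_sum fun i hi => hD i (Finset.mem_range.1 hi)
    _ = L * D := by rw [Finset.sum_const, Finset.card_range, smul_eq_mul]

/-- **Prefix sums by one multiplication**: `(kpack b L d · onesV b L) &&& (2^{bL} − 1) = kpack b L (psumF d)`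
whenever `Σ_{j<L} d_j < 2^b` (no carries in the low `L` slots of the product). [cite: GathenGerhard2013ModernComputerAlgebra, §8.4 (Kronecker substitution)] -/
theorem kpack_mul_onesV_low {b L : ℕ} (hb : 1 ≤ b) {d : ℕ → ℕ} (hsum : ∑ i ∈ range L, d i < 2 ^ b) :
    (kpack b L d * onesV b L) &&& (2 ^ (b * L) - 1) = kpack b L (psumF d) := by
  have hlow : ∀ j < L, dconvNat (truncSeq L d) (truncSeq L fun _ => 1) j < 2 ^ b := fun j hj => by
    rw [dconvNat_truncSeq_ones d hj]
    exact (psumF_le_sum d hj).trans_lt hsum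
  rw [onesV_eq_kpack hb, kpack_mul_kpack, Nat.and_two_pow_sub_one_eq_mod,
    kpack_mod_two_pow (by omega : L ≤ 2 * L) hlow]
  exact kpack_congr fun j hj => dconvNat_truncSeq_ones d hj

/-! ### Spreading bits to digits -/

/-- `spreadChunk b c x = (x · onesV (b−1) c) &&& onesV b c`: bit `r` of `x` (`r < c ≤ b − 1`, `x < 2^c`) moved
to bit position `br` — the packed 0/1 vector of the bits of `x`. [cite: GathenGerhard2013ModernComputerAlgebra, §8.4 (Kronecker substitution)] -/
def spreadChunk (b c x : ℕ) : ℕ := (x * onesV (b - 1) c) &&& onesV b c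

/-- The bits of a `0/1` digit. [folklore] -/
private theorem testBit_toNat (v : Bool) (i : ℕ) : (v.toNat).testBit i = (v && decide (i = 0)) := by
  cases v
  · simp
  · cases i <;> simp [Nat.testBit_succ]

/-- Division with remainder of `(k+1)t + t` by `k + 1`... stated for `b t = (b−1) t + t`: quotient and remainder of
`b·t` by `b − 1` are both `t` when `t < b − 1`. [folklore] -/
private theorem div_mod_pred {b t : ℕ} (hb : 2 ≤ b) (ht : t < b - 1) :
    b * t / (b - 1) = t ∧ b * t % (b - 1) = t := by
  have h : b * t = t + (b - 1) * t := by
    obtain ⟨b', rfl⟩ : ∃ b', b = b' + 1 := ⟨b - 1, by omega⟩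
    simp only [Nat.add_sub_cancel]
    ring
  rw [h, Nat.add_mul_div_left _ _ (by omega), Nat.add_mul_mod_self_left, Nat.div_eq_of_lt ht,
    Nat.mod_eq_of_lt ht]
  exact ⟨by simp, rfl⟩

/-- **`spreadChunk` spreads**: for `x < 2^c`, `c ≤ b − 1`, `spreadChunk b c x = kpack b c (r ↦ bit_r(x))`.
[cite: GathenGerhard2013ModernComputerAlgebra, §8.4 (Kronecker substitution)] -/
theorem spreadChunk_eq {b c x : ℕ} (hb : 2 ≤ b) (hc : c ≤ b - 1) (hx : x < 2 ^ c) :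
    spreadChunk b c x = kpack b c fun r => (x.testBit r).toNat := by
  have hb1 : 1 ≤ b - 1 := by omega
  have hx' : ∀ j < c, (fun _ : ℕ => x) j < 2 ^ (b - 1) := fun _ _ =>
    hx.trans_le (Nat.pow_le_pow_right (by norm_num) hc)
  have hbits : ∀ j < c, (fun r => (x.testBit r).toNat) j < 2 ^ b := fun j _ =>
    (Bool.toNat_le _).trans_lt (Nat.one_lt_two_pow (by omega))
  have hmask : onesV b c = kpack b c fun _ => 2 ^ 1 - 1 := by
    rw [onesV_eq_kpack (by omega)]; exact kpack_congr fun _ _ => by norm_num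
  have hmul : x * onesV (b - 1) c = kpack (b - 1) c fun _ => x := by
    rw [onesV_eq_kpack hb1, kpack_smul]; simp only [mul_one]
  rw [spreadChunk, hmul, hmask]
  refine Nat.eq_of_testBit_eq fun i => ?_
  rw [Nat.testBit_and, testBit_kpack (by omega) hx', testBit_kpack_const_mask (by omega) (by omega),
    testBit_kpack (by omega) hbits, testBit_toNat]
  -- write `i = b t + r`
  obtain ⟨t, r, hr, rfl⟩ : ∃ t r, r < b ∧ i = b * t + r := ⟨i / b, i % b, Nat.mod_lt i (by omega),
    (Nat.div_add_mod i b).symm⟩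
  have hdiv : (b * t + r) / b = t := by rw [Nat.add_comm, Nat.add_mul_div_left _ _ (by omega), Nat.div_eq_of_lt hr, zero_add]
  have hmod : (b * t + r) % b = r := by rw [Nat.add_comm, Nat.add_mul_mod_self_left, Nat.mod_eq_of_lt hr]
  rw [hdiv, hmod]
  by_cases htc : t < c
  · by_cases hr0 : r = 0
    · subst hr0
      obtain ⟨hq, hm⟩ := div_mod_pred hb (lt_of_lt_of_le htc hc)
      simp only [add_zero, hq, hm, if_pos htc]
      simp [htc]
    · have hr1 : ¬ r < 1 := by omega
      simp [htc, hr0, hr1]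
  · simp [htc]

/-- `spreadBits b c A i`: the low `c·i` bits of `A` spread to digits, chunk by chunk (`i` chunks of `c` bits).
[cite: GathenGerhard2013ModernComputerAlgebra, §8.4 (Kronecker substitution)] -/
def spreadBits (b c A : ℕ) : ℕ → ℕ
  | 0 => 0
  | i + 1 => spreadBits b c A i + (spreadChunk b c ((A >>> (c * i)) % 2 ^ c) <<< (b * (c * i)))

/-- **`spreadBits` spreads**: `spreadBits b c A i = kpack b (c·i) (r ↦ bit_r(A))` (`1 ≤ c ≤ b − 1`).
[cite: GathenGerhard2013ModernComputerAlgebra, §8.4 (Kronecker substitution)] -/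
theorem spreadBits_eq {b c A : ℕ} (hb : 2 ≤ b) (hc : c ≤ b - 1) :
    ∀ i : ℕ, spreadBits b c A i = kpack b (c * i) fun r => (A.testBit r).toNat
  | 0 => by simp [spreadBits]
  | i + 1 => by
    rw [spreadBits, spreadBits_eq hb hc i, spreadChunk_eq hb hc (Nat.mod_lt _ (by positivity)),
      Nat.shiftLeft_eq, show c * (i + 1) = c * i + c by ring, kpack_add, mul_comm (2 ^ (b * (c * i)))]
    congr 1
    congr 1
    refine kpack_congr fun r hr => ?_
    rw [Nat.testBit_mod_two_pow, Nat.testBit_shiftRight, decide_eq_true hr, Bool.true_and]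

/-! ### Periodic extension by one multiplication -/

/-- `pext b L n T = T · onesV (bL) n`: `n` consecutive copies of a table `T` of `L` digits.
[cite: GathenGerhard2013ModernComputerAlgebra, §8.4 (Kronecker substitution)] -/
def pext (b L n T : ℕ) : ℕ := T * onesV (b * L) n

/-- `n` copies of a packed vector of `L` digits are the packed vector of the `L`-periodic digit function over
`L·n` slots. [cite: GathenGerhard2013ModernComputerAlgebra, §8.4 (Kronecker substitution)] -/
theorem kpack_copies (b L : ℕ) (d : ℕ → ℕ) :
    ∀ n : ℕ, kpack (b * L) n (fun _ => kpack b L d) = kpack b (L * n) fun s => d (s % L)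
  | 0 => by simp
  | n + 1 => by
    rw [kpack_succ, kpack_copies b L d n, show L * (n + 1) = L * n + L by ring, kpack_add,
      show b * (L * n) = b * L * n by ring, mul_comm (2 ^ (b * L * n))]
    congr 2
    exact kpack_congr fun i hi => by rw [Nat.mul_add_mod_self_left, Nat.mod_eq_of_lt hi]

/-- **Periodic extension**: `pext b L n (kpack b L d) = kpack b (L·n) (s ↦ d (s mod L))` (`b, L ≥ 1`; no digit
condition — it is an identity of integers). [cite: GathenGerhard2013ModernComputerAlgebra, §8.4 (Kronecker substitution)] -/
theorem pext_kpack {b L : ℕ} (hb : 1 ≤ b) (hL : 1 ≤ L) (n : ℕ) (d : ℕ → ℕ) :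
    pext b L n (kpack b L d) = kpack b (L * n) fun s => d (s % L) := by
  have hbL : 1 ≤ b * L := Nat.mul_le_mul hb hL
  rw [pext, onesV_eq_kpack hbL n, kpack_smul, ← kpack_copies b L d n]
  exact kpack_congr fun j _ => mul_one _

end FeketePolyaKernel

end Literature.NumberTheory.LFunctions
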